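import Mathlib
import Summits.Ventures.PercRepro2.ZMeanProof
import Summits.Ventures.PercRepro2.HCovSwap
import Summits.Ventures.PercRepro2.HMFPendantRoot

/-!
# The mean-field functional is symmetric in the two roots (blind cell PercRepro2, night-1 g16;
NIGHT1-G16.md §6′)

`HMFc p ends o a₂ a₁ a₃ b = HMFc p ends o a₁ a₂ a₃ b` (**`HMFc_root_swap`**): the events `Q`, `PD`
are symmetric (`avoidAll_root_swap`, `PDEvent_root_swap`), the mean field `X̂` is symmetric
(`Xhat_root_swap`: the per-cluster term `termW` exchanges its two `termT` branches and `termPD` is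
symmetric through `delQ`), the `σ`-moments of `marginC` change sign together with `gap`, and the
ONE asymmetric mass `W = M₂ + Δ_T` differs from its mirror by exactly `gap`
(`W_sub_swap_eq_gap`: `Qsplit` on `{b ∈ C₂}` and `{b ∈ C₁}` with `gap_eq_Q`) — which the factor
`2 P(Q) D_o` of the cleared form absorbs.  Hence **`HMF_root_swap`** and the pendant-at-root theorem
transfers to the other root at (HMF) strength: **`HMF_pendant_root'`** (`a₃` a leaf at `a₁`).

Own code; standard axioms.
-/

namespace Summit.Ventures.PercRepro2

open UnionCluster CovForm

namespace HMFSwap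

variable {V : Type*} {E : Type*} [Fintype E] [DecidableEq E] [Fintype V] [DecidableEq V]
  {R : Type*} [Field R] [LinearOrder R] [IsStrictOrderedRing R]

omit [Fintype E] [DecidableEq E] in
/-- The residual disconnection event is symmetric in the roots. -/
lemma delQ_root_swap (ends : E → Sym2 V) (W : Finset V) (a₁ a₂ : V) :
    delQ ends W a₂ a₁ = delQ ends W a₁ a₂ := by
  unfold delQ connDelEvent
  ext ω
  simp only [Set.mem_compl_iff, Set.mem_setOf_eq]
  exact ⟨fun h hc => h (conn_symm hc), fun h hc => h (conn_symm hc)⟩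

omit [LinearOrder R] [IsStrictOrderedRing R] in
/-- The PD-type per-cluster term is symmetric in the roots. -/
lemma termPD_root_swap (p : E → R) (ends : E → Sym2 V) (W : Finset V) (o a₁ a₂ b : V) :
    termPD p ends W o a₂ a₁ b = termPD p ends W o a₁ a₂ b := by
  unfold termPD delShareMass
  rw [delQ_root_swap]
  ring

omit [LinearOrder R] [IsStrictOrderedRing R] in
/-- The per-cluster term of `X̂` is symmetric in the roots. -/
lemma termW_root_swap (p : E → R) (ends : E → Sym2 V) (o a₁ a₂ b : V) (W : Finset V) :
    termW p ends o a₂ a₁ b W = termW p ends o a₁ a₂ b W := by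
  unfold termW
  by_cases h1 : a₁ ∈ W <;> by_cases h2 : a₂ ∈ W <;> simp [h1, h2, termPD_root_swap]

omit [LinearOrder R] [IsStrictOrderedRing R] in
/-- **The mean field `X̂` is symmetric in the roots.** -/
lemma Xhat_root_swap (p : E → R) (ends : E → Sym2 V) (o a₁ a₂ a₃ b : V) :
    Xhat p ends o a₂ a₁ a₃ b = Xhat p ends o a₁ a₂ a₃ b := by
  rw [Xhat_eq_sum, Xhat_eq_sum]
  exact Finset.sum_congr rfl fun W _ => by rw [termW_root_swap]

omit [Fintype V] in
/-- **The one asymmetric mass**: `W − W′ = gap` for `W = M₂ + Δ_T` and its root mirror `W′`. -/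
lemma W_sub_swap_eq_gap (p : E → R) (ends : E → Sym2 V) (a₁ a₂ a₃ b : V) :
    (massM2 p ends a₁ a₂ a₃ b + deltaT p ends a₁ a₂ a₃ b) -
        (massM2 p ends a₂ a₁ a₃ b + deltaT p ends a₂ a₁ a₃ b) = gap p ends a₁ a₂ b := by
  unfold massM2 deltaT
  rw [gap_eq_Q, PDEvent_root_swap ends a₁ a₂ a₃, Qsplit p ends a₁ a₂ a₃ (connEvent ends a₂ b),
    Qsplit p ends a₁ a₂ a₃ (connEvent ends a₁ b),
    Set.inter_comm (connEvent ends a₂ b) (TEvent ends a₁ a₂ a₃),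
    Set.inter_comm (connEvent ends a₁ b) (TEvent ends a₁ a₂ a₃),
    Set.inter_comm (connEvent ends a₁ b) (TEvent ends a₂ a₁ a₃),
    Set.inter_comm (connEvent ends a₂ b) (TEvent ends a₂ a₁ a₃)]
  ring

omit [Fintype V] [DecidableEq V] [LinearOrder R] [IsStrictOrderedRing R] in
/-- The gap changes sign under the root swap. -/
lemma gap_root_swap (p : E → R) (ends : E → Sym2 V) (a₁ a₂ b : V) :
    gap p ends a₂ a₁ b = - gap p ends a₁ a₂ b := by
  unfold gap; ring

/-- **`HMFc` is symmetric in the two roots.** -/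
theorem HMFc_root_swap (p : E → R) (ends : E → Sym2 V) (o a₁ a₂ a₃ b : V) :
    HMFc p ends o a₂ a₁ a₃ b = HMFc p ends o a₁ a₂ a₃ b := by
  have hW := W_sub_swap_eq_gap p ends a₁ a₂ a₃ b
  unfold HMFc marginC DEF Do EQo EQ3 EQ3o
  rw [avoidAll_root_swap ends a₁ a₂, PDEvent_root_swap ends a₁ a₂ a₃, Xhat_root_swap,
    gap_root_swap]
  linear_combination (-2 * prob p (avoidAll ends a₂ {a₁}) *
    (prob p (PDEvent ends a₁ a₂ a₃ ∩ connEvent ends a₁ o) +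
      prob p (PDEvent ends a₁ a₂ a₃ ∩ connEvent ends a₂ o))) * hW

/-- **(HMF) is symmetric in the two roots.** -/
theorem HMF_root_swap (p : E → R) (ends : E → Sym2 V) (o a₁ a₂ a₃ b : V) :
    HMF p ends o a₂ a₁ a₃ b ↔ HMF p ends o a₁ a₂ a₃ b := by
  unfold HMF
  rw [HMFc_root_swap]

/-- **(HMF) at a pendant `a₃` attached to the root `a₁`** (by the root symmetry). -/
theorem HMF_pendant_root' (p : E → R) (ends : E → Sym2 V) (hp : IsProbVec p) {f : E} {a₃ a₁ : V}
    (hf : ends f = s(a₃, a₁)) (hleaf : ∀ e, a₃ ∈ ends e → e = f) (h31 : a₃ ≠ a₁) {o a₂ b : V}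
    (h32 : a₃ ≠ a₂) (ho : o ≠ a₃) (hb : b ≠ a₃) : HMF p ends o a₁ a₂ a₃ b :=
  (HMF_root_swap p ends o a₁ a₂ a₃ b).1
    (HMFPendantRoot.HMF_pendant_root p ends hp hf hleaf h31 h32 ho hb)

end HMFSwap

end Summit.Ventures.PercRepro2
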